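import Summits.FinalStateConjecture.FinalStateConjecture.Theorems.EIHFluxBalanceInertialRecessionRechartCarterCertify
import Summits.FinalStateConjecture.FinalStateConjecture.Theorems.EIHFluxBalanceInertialRecessionRechartCarterRaise
import Summits.FinalStateConjecture.FinalStateConjecture.Theorems.EIHFluxBalanceInertialRecessionRechartClockDictionary
import Summits.FinalStateConjecture.FinalStateConjecture.Theorems.EIHFluxBalanceInertialRecessionRechartTiltEnvelope
import Summits.FinalStateConjecture.FinalStateConjecture.Theorems.EIHFluxBalanceInertialRecessionRechartMesh
import Summits.FinalStateConjecture.FinalStateConjecture.Theorems.EIHFluxBalanceInertialRecessionStubRechart3Coverage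
import Summits.FinalStateConjecture.FinalStateConjecture.Theorems.EIHFluxBalanceInertialRecessionStubRechart3HoleLimit
import Summits.FinalStateConjecture.FinalStateConjecture.Theorems.EIHFluxBalanceInertialRecessionStubRechart3ClockBounds
import Summits.FinalStateConjecture.FinalStateConjecture.Theorems.EIHFluxBalanceInertialRecessionStubRechart11Core
import Summits.FinalStateConjecture.FinalStateConjecture.Theorems.EIHFluxBalanceInertialRecessionRechartClockTransferHole
import Literature.Geometry.Lorentzian.KerrWaveDecay

/-!
# Route EIHFluxBalance — `InertialRecession` (E′), re-charting on the given region: the CLOCK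
# DICTIONARY, COVERAGE and CARTER REACH of one rest-frame clock chart (inputs of …RechartTransfer3)

Helper file for the crux `stmt-FinalStateConjecture-17403`
(`Summit.FinalStateConjecture.FinalStateConjecture.Theses.EIHFluxBalance.InertialRecession`, E′),
line `SketchCleanExcision`, stub `stub_rechartOnRegion` (P2′).

For the rest-frame clock chart `Ψ_A = Φ ∘ A` of one hole (`A = honestChart Λ̃ ξ T₀ ∘ C`,
…StubRechart3Package) this file manufactures the per-hole inputs of the causal transfer
`exterior_subset_certified_union_causalPast₃` (…RechartTransfer3):
* `exists_clockDictionary_r12` — the lab clock `θ = T₀⁻¹` (`exists_labClock`), its growth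
  (`θ → ∞`, `0 ≤ θ t ≤ t − T₀ 0` after `T₀ 0`), and the tilt `β = (1 + |a|/r₊)·β₀` with `β₀` the
  envelope of `√(ũ⁰² − 1)` over the window `[t/2, ∞)` (`exists_tilt_envelope`), together with the
  SLACK DICHOTOMY `∀ n, ∀ᶠ t, β(t)·n ≤ (t − θ t) + (1 + |T₀ 0|)` (`eventually_tilt_mul_le_slack`: the
  Lorentz factor `ũ⁰` is eventually `1`-Lipschitz by slaving, the slack has rate `1 − 1/ũ⁰`);
* `clock_coverage_r12` — coverage at a fixed stage with the SHARP time clause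
  `|y⁰ − θ(x⁰)| ≤ β(x⁰)·r` (`coverage_of_honest` + `abs_modelTime_sub_clock_le`; `‖ỹ‖ ≤ r + |a|`);
* `clock_innerDictionary_r12` — inside a fixed zone radius the painted radius of a late chart point
  `A y` IS `r_a(y)` (`r_a(C y) ≤ ‖(C y)~‖ ≤ ‖ỹ‖`, coverage at a fixed radius, injectivity of `A`);
* `exists_clock_reach_r12` — a monotone reach profile `Rr → ∞` along which `Ψ_A` converges and the
  certified Carter reach holds on `{r ≥ r₊ + 1}` (`exists_carter_hraise`, `exists_carter_reach`);
Cf. the rest-frame dictionaries `coverage_dictionary` / `lab_dictionary` of …RechartClockCoverage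
(old item, crude time clause); here the time clause is read through the tilt envelope at the hole's
window `[x⁰/2, ∞)`, as the ball profile of …RechartClockBallProfile wants it.
[O'Neill 1983, Ch. 14; Carter 1968; folklore]
-/

noncomputable section

set_option linter.dupNamespace false

open Set Filter Topology Function TopologicalSpace Literature.Geometry.Lorentzian
open Summit.FinalStateConjecture.FinalStateConjecture.Theorems.SublinearIsFree.Rechart
open scoped Manifold ContDiff ENNReal

namespace Summit.FinalStateConjecture.FinalStateConjecture.Theorems

/-! ### Bookkeeping -/

/-- The time component of a differentiable path in `E4` has derivative the time component of the
derivative. [folklore] -/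
theorem deriv_apply_zero_r12 {u : ℝ → E4} (hu : Differentiable ℝ u) (t : ℝ) :
    deriv (fun s ↦ u s 0) t = deriv u t 0 := by
  have h := ((EuclideanSpace.proj (0 : Fin 4) : E4 →L[ℝ] ℝ).hasFDerivAt.comp_hasDerivAt t
    (hu t).hasDerivAt)
  exact h.deriv

/-! ### The lab clock, the tilt and the slack dichotomy -/

section Dictionary

variable (Λ : ℝ → lorentzGroup) (T₀ : ℝ → ℝ)
  (hΛ : ContDiff ℝ ∞ (fun t ↦ ((Λ t : E4 ≃L[ℝ] E4) : E4 →L[ℝ] E4)))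
  (hdec : ∀ m, 1 ≤ m → m ≤ 3 → Tendsto (fun t ↦ iteratedDeriv m
    (fun s ↦ ((Λ s : E4 ≃L[ℝ] E4) : E4 →L[ℝ] E4)) t) atTop (𝓝 0))
  {γ : ℝ} (hγ1 : 1 ≤ γ) (huγ : ∀ t, |((Λ t : E4 ≃L[ℝ] E4) (E4.basisVector 0)) 0| ≤ γ)
  (hpos : ∀ t, 0 < ((Λ t : E4 ≃L[ℝ] E4) (E4.basisVector 0)) 0)
  (hclock : ∀ τ, HasDerivAt T₀ (frameVel (Λ (T₀ τ)) 0) τ)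
  (hT₀lo : ∀ σ τ, σ ≤ τ → τ - σ ≤ T₀ τ - T₀ σ) (hT₀hi : ∀ σ τ, σ ≤ τ → T₀ τ - T₀ σ ≤ γ * (τ - σ))

include hΛ hdec hγ1 huγ hpos hclock hT₀lo hT₀hi in
/-- **The clock dictionary of a clock chart.** See the module docstring: the lab clock `θ`, the
tilt `β = L·β₀` for a prescribed factor `L ≥ 1`, and the slack dichotomy. [folklore] -/
theorem exists_clockDictionary_r12 {L : ℝ} (hL : 1 ≤ L) :
    ∃ θ β : ℝ → ℝ, (∀ τ, θ (T₀ τ) = τ) ∧ (∀ t, T₀ (θ t) = t) ∧ Monotone θ ∧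
      (∀ t t', t' ≤ t → θ t - θ t' ≤ t - t') ∧ Tendsto θ atTop atTop ∧
      (∀ t, T₀ 0 ≤ t → 0 ≤ θ t ∧ θ t ≤ t - T₀ 0) ∧
      (∀ t, 0 ≤ β t) ∧ (∀ t, β t ≤ L * γ) ∧
      (∀ t σ, t / 2 ≤ σ →
        L * Real.sqrt ((((Λ σ : E4 ≃L[ℝ] E4) (E4.basisVector 0)) 0) ^ 2 - 1) ≤ β t) ∧
      (∀ n : ℕ, ∀ᶠ t in atTop, β t * n ≤ (t - θ t) + (1 + |T₀ 0|)) := by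
  have hγ0 : 0 ≤ γ := zero_le_one.trans hγ1
  have hL0 : 0 ≤ L := zero_le_one.trans hL
  -- the Lorentz factor
  set u : ℝ → ℝ := fun t ↦ ((Λ t : E4 ≃L[ℝ] E4) (E4.basisVector 0)) 0 with hu
  have hu1 : ∀ t, 1 ≤ u t := fun t ↦ by
    have h := one_le_abs_lorentz_apply_zero (Λ t)
    rwa [abs_of_pos (hpos t)] at h
  have huγ' : ∀ t, u t ≤ γ := fun t ↦ (le_abs_self _).trans (huγ t)
  have hLγ : ∀ t, u t ≤ L * γ := fun t ↦ (huγ' t).trans (by nlinarith)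
  -- the lab clock
  obtain ⟨θ, hθT, hTθ, hθm, hθ1, hslm⟩ := exists_labClock hT₀lo hT₀hi
  have hθc : Continuous θ := by
    refine (LipschitzWith.of_dist_le_mul (K := 1) fun t t' ↦ ?_).continuous
    rw [Real.dist_eq, Real.dist_eq, NNReal.coe_one, one_mul]
    exact one_lipschitz_abs_rechart hθm hθ1 t t'
  have hθtop : Tendsto θ atTop atTop := by
    refine tendsto_atTop_atTop.mpr fun b ↦ ⟨T₀ (max b 0), fun t ht ↦ ?_⟩
    have h := hθm ht
    rw [hθT] at h
    exact (le_max_left _ _).trans h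
  have hθbd : ∀ t, T₀ 0 ≤ t → 0 ≤ θ t ∧ θ t ≤ t - T₀ 0 := fun t ht ↦ by
    have h1 : θ (T₀ 0) ≤ θ t := hθm ht
    rw [hθT] at h1
    have h2 := hθ1 t (T₀ 0) ht
    rw [hθT] at h2
    exact ⟨h1, by linarith⟩
  -- the envelope
  obtain ⟨β₀, -, hβ₀0, hβ₀γ, hβ₀dom, hβ₀lim⟩ := exists_tilt_envelope (u := u) hu1 huγ'
  set β : ℝ → ℝ := fun t ↦ L * β₀ t with hβ
  refine ⟨θ, β, hθT, hTθ, hθm, hθ1, hθtop, hθbd, fun t ↦ mul_nonneg hL0 (hβ₀0 t),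
    fun t ↦ mul_le_mul_of_nonneg_left (hβ₀γ t) hL0,
    fun t σ hσ ↦ mul_le_mul_of_nonneg_left (hβ₀dom t σ hσ) hL0, fun n ↦ ?_⟩
  -- the slack dichotomy
  have hud : Differentiable ℝ u := by
    have h : ContDiff ℝ ∞ fun t ↦ frameVel (Λ t) 0 := contDiff_frameVel_zero Λ hΛ
    exact h.differentiable (by simp)
  have hu' : Tendsto (deriv u) atTop (𝓝 0) := by
    have h1 := tendsto_iteratedDeriv_frameVel Λ hΛ hdec 1 le_rfl (by norm_num)
    simp only [iteratedDeriv_one] at h1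
    have hfd : Differentiable ℝ fun s ↦ frameVel (Λ s) := (contDiff_frameVel Λ hΛ).differentiable (by simp)
    have heq : deriv u = fun t ↦ deriv (fun s ↦ frameVel (Λ s)) t 0 :=
      funext fun t ↦ deriv_apply_zero_r12 hfd t
    rw [heq]
    have h2 := ((EuclideanSpace.proj (0 : Fin 4) : E4 →L[ℝ] ℝ).continuous.tendsto 0).comp h1
    rw [map_zero] at h2
    exact h2
  obtain ⟨T₁, hlip⟩ := exists_lipschitz_of_tendsto_deriv hud hu'
  have hs : ∀ t, HasDerivAt (fun t ↦ t - θ t) (1 - (u t)⁻¹) t :=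
    hasDerivAt_slack (u0 := u) hclock hu1 hθc hTθ
  have hs₀ : ∀ t, T₀ 0 ≤ t → 1 ≤ (t - θ t) + (1 + |T₀ 0|) := fun t ht ↦ by
    have := (hθbd t ht).2
    have := neg_abs_le (T₀ 0)
    linarith
  have h := eventually_tilt_mul_le_slack (u := u) (s := fun t ↦ t - θ t) (β := β) hu1 hLγ one_pos hlip hs
    (fun t ↦ (mul_le_mul_of_nonneg_left (hβ₀γ t) hL0)) (fun hu ↦ ?_) hs₀ (Nat.cast_nonneg n)
  · exact h
  · have := (hβ₀lim hu).const_mul L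
    rw [mul_zero] at this
    exact this

end Dictionary

/-! ### Coverage with the sharp time clause; the inner dictionary -/

section Coverage

variable (Λ : ℝ → lorentzGroup) (ξ : ℝ → E3) (T₀ : ℝ → ℝ)
  (hΛ : ContDiff ℝ ∞ (fun t ↦ ((Λ t : E4 ≃L[ℝ] E4) : E4 →L[ℝ] E4)))
  (hT₀ : ContDiff ℝ ∞ T₀) {γ : ℝ} (hγ1 : 1 ≤ γ) (huγ : ∀ t, |((Λ t : E4 ≃L[ℝ] E4) (E4.basisVector 0)) 0| ≤ γ)
  (hT₀lo : ∀ σ τ, σ ≤ τ → τ - σ ≤ T₀ τ - T₀ σ) (a : ℝ)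
  {A : E4 → E4} (hhon : ∀ K : ℝ, ∃ τK : ℝ, ∀ y : E4, τK ≤ y 0 → ‖E4.spatial y‖ ≤ K →
    A =ᶠ[𝓝 y] honestChart Λ ξ T₀)

include hΛ hT₀ hγ1 huγ hT₀lo hhon in
/-- **Coverage at a fixed stage with the sharp time clause.** With the lab clock `θ`
(`θ ∘ T₀ = id`, monotone, `1`-Lipschitz) and a tilt `β` dominating `(1 + |a|/rH)·√(ũ⁰(σ)² − 1)` for
`σ ≥ t/2`: there is a lab time `tR` after which every lab point `x` with painted radius
`r ∈ (rH, R]` and `16γ²(R + |a|) ≤ x⁰/2` is `A y` with `r_a(y) = r` and `|y⁰ − θ(x⁰)| ≤ β(x⁰)·r`.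
[folklore] -/
theorem clock_coverage_r12 {θ β : ℝ → ℝ} (hθT : ∀ τ, θ (T₀ τ) = τ) (hθm : Monotone θ)
    (hθ1 : ∀ t t', t' ≤ t → θ t - θ t' ≤ t - t') {rH : ℝ} (hrH : 0 < rH)
    (hβ : ∀ t σ, t / 2 ≤ σ →
      (1 + |a| / rH) * Real.sqrt ((((Λ σ : E4 ≃L[ℝ] E4) (E4.basisVector 0)) 0) ^ 2 - 1) ≤ β t)
    (R : ℝ) : ∃ tR : ℝ, ∀ x : E4, tR ≤ x 0 → 16 * γ ^ 2 * (R + |a|) ≤ x 0 / 2 →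
      rH < Kerr.radius a (poincareInv (Λ (x 0)) (E4.ofTimeSpace (x 0) (ξ (x 0))) x) →
      Kerr.radius a (poincareInv (Λ (x 0)) (E4.ofTimeSpace (x 0) (ξ (x 0))) x) ≤ R →
      ∃ y : E4, A y = x ∧
        Kerr.radius a y = Kerr.radius a (poincareInv (Λ (x 0)) (E4.ofTimeSpace (x 0) (ξ (x 0))) x) ∧
        |y 0 - θ (x 0)| ≤ β (x 0) * Kerr.radius a (poincareInv (Λ (x 0)) (E4.ofTimeSpace (x 0) (ξ (x 0))) x) := by
  obtain ⟨tR, htR⟩ := coverage_of_honest Λ ξ T₀ hΛ hT₀ hγ1 huγ hT₀lo a hhon R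
  refine ⟨tR, fun x hx hxw hxr hxR ↦ ?_⟩
  obtain ⟨y, hAy, hψy, hry, hyw, hyt⟩ := htR x hx hxR
  refine ⟨y, hAy, hry, ?_⟩
  set r := Kerr.radius a (poincareInv (Λ (x 0)) (E4.ofTimeSpace (x 0) (ξ (x 0))) x) with hr
  have hr0 : 0 < r := hrH.trans hxr
  -- the sharp dictionary at `y`
  have h1 := abs_modelTime_sub_clock_le Λ ξ T₀ hθT hθm hθ1 y
  rw [hψy] at h1
  -- the clock time of `y` lies in the window `[x⁰/2, ∞)`
  have hσ : x 0 / 2 ≤ T₀ (y 0) := by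
    have := (abs_le.mp hyt).1; linarith
  have h2 := hβ (x 0) (T₀ (y 0)) hσ
  -- `‖ỹ‖ ≤ r + |a| ≤ (1 + |a|/rH) r`
  have h3 : ‖E4.spatial y‖ ≤ (1 + |a| / rH) * r := by
    have h4 : ‖E4.spatial y‖ ≤ Kerr.radius a y + |a| := spatialNorm_le_radius_add_abs a y
    rw [hry] at h4
    have h5 : |a| ≤ |a| / rH * r := by
      rw [div_mul_eq_mul_div, le_div_iff₀ hrH]
      exact mul_le_mul_of_nonneg_left hxr.le (abs_nonneg a)
    linarith
  have hs0 : 0 ≤ Real.sqrt ((((Λ (T₀ (y 0)) : E4 ≃L[ℝ] E4) (E4.basisVector 0)) 0) ^ 2 - 1) :=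
    Real.sqrt_nonneg _
  calc |y 0 - θ (x 0)| ≤ Real.sqrt ((((Λ (T₀ (y 0)) : E4 ≃L[ℝ] E4) (E4.basisVector 0)) 0) ^ 2 - 1) *
        ‖E4.spatial y‖ := h1
    _ ≤ Real.sqrt ((((Λ (T₀ (y 0)) : E4 ≃L[ℝ] E4) (E4.basisVector 0)) 0) ^ 2 - 1) *
        ((1 + |a| / rH) * r) := mul_le_mul_of_nonneg_left h3 hs0
    _ = (1 + |a| / rH) * Real.sqrt ((((Λ (T₀ (y 0)) : E4 ≃L[ℝ] E4) (E4.basisVector 0)) 0) ^ 2 - 1) * r := by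
        ring
    _ ≤ β (x 0) * r := mul_le_mul_of_nonneg_right h2 hr0.le

include hΛ hT₀ hγ1 huγ hT₀lo hhon in
/-- **The inner dictionary.** If `A = honestChart ∘ C` with `‖(C y)~‖ ≤ ‖ỹ‖` and `A` is injective,
then for every zone radius `Rz` there is a lab time after which the painted radius of a chart point
`A y` with `r_a(y) < Rz` IS `r_a(y)`. [folklore] -/
theorem clock_innerDictionary_r12 {C : E4 → E4} (hAC : ∀ y, A y = honestChart Λ ξ T₀ (C y))
    (hCle : ∀ y, ‖E4.spatial (C y)‖ ≤ ‖E4.spatial y‖) (hinj : Injective A) (Rz : ℝ) :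
    ∃ Tlab : ℝ, ∀ y : E4, Tlab ≤ A y 0 → Kerr.radius a y < Rz →
      Kerr.radius a (poincareInv (Λ (A y 0)) (E4.ofTimeSpace (A y 0) (ξ (A y 0))) (A y)) =
        Kerr.radius a y := by
  obtain ⟨tR, htR⟩ := coverage_of_honest Λ ξ T₀ hΛ hT₀ hγ1 huγ hT₀lo a hhon (max Rz 0 + |a|)
  refine ⟨tR, fun y hy hyr ↦ ?_⟩
  -- the painted radius of `A y` is `r_a(C y) ≤ ‖(C y)~‖ ≤ ‖ỹ‖ ≤ max Rz 0 + |a|`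
  have hrad : Kerr.radius a (poincareInv (Λ (A y 0)) (E4.ofTimeSpace (A y 0) (ξ (A y 0))) (A y)) =
      Kerr.radius a (C y) := by
    rw [hAC, honestChart_apply_zero, radius_poincareInv_honestChart]
  have hle : Kerr.radius a (poincareInv (Λ (A y 0)) (E4.ofTimeSpace (A y 0) (ξ (A y 0))) (A y)) ≤
      max Rz 0 + |a| := by
    rw [hrad]
    exact (Kerr.radius_le_spatialNorm a (C y)).trans ((hCle y).trans (norm_spatial_le_of_radius_le a y hyr.le))
  obtain ⟨y', hAy', -, hry', -, -⟩ := htR (A y) hy hle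
  rw [← hry', hinj hAy']

end Coverage

/-! ### The certified Carter reach along a convergent profile -/

section Reach

variable {𝓢 : Spacetime 4} (U : Opens E4) (Φ : U → 𝓢.carrier) (hΦ : ContMDiff 𝓘(ℝ, E4) (𝓡 4) ∞ Φ)
  (Qp : U → Prop)
  (hOfut : ∀ x : U, Qp x → ∀ w : E4, 0 < w 0 →
    𝓢.metric.val (Φ x) (mfderiv 𝓘(ℝ, E4) (𝓡 4) Φ x w) (mfderiv 𝓘(ℝ, E4) (𝓡 4) Φ x w) < 0 →
      𝓢.timeOrientation.IsFutureDirected (mfderiv 𝓘(ℝ, E4) (𝓡 4) Φ x w))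
  {M a : ℝ} (hsub : Kerr.IsSubextremal M a)
  (Λ : ℝ → lorentzGroup) (ξ : ℝ → E3) (T₀ : ℝ → ℝ)
  (hΛ : ContDiff ℝ ∞ (fun t ↦ ((Λ t : E4 ≃L[ℝ] E4) : E4 →L[ℝ] E4)))
  (hξ : ContDiff ℝ ∞ ξ) (hT₀ : ContDiff ℝ ∞ T₀)
  (hclock : ∀ τ, deriv T₀ τ = frameVel (Λ (T₀ τ)) 0) (hpos : ∀ t, 0 < frameVel (Λ t) 0)
  (hdec : Tendsto (fun t ↦ deriv (fun s ↦ frameTilt (Λ s)) t) atTop (𝓝 0))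
  (htop : Tendsto T₀ atTop atTop) {A : E4 → E4} (hA : ContDiff ℝ ∞ A)
  (hAU : ∀ y ∈ (boostedKerrBackground 1 0 M a).domain, A y ∈ U)
  (hhon : ∀ K : ℝ, ∃ τK : ℝ, ∀ y : E4, τK ≤ y 0 → ‖E4.spatial y‖ ≤ K →
    A =ᶠ[𝓝 y] honestChart Λ ξ T₀)
  (hQA : ∀ (y : E4) (hy : y ∈ (boostedKerrBackground 1 0 M a).domain), Qp ⟨A y, hAU y hy⟩)
  (hconvR : ∀ R : ℝ, Tendsto (fun τ ↦ 𝓢.truncDeviationCk (boostedKerrBackground 1 0 M a)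
    (fun y : (boostedKerrBackground 1 0 M a).domain ↦ Φ ⟨A y.1, hAU y.1 y.2⟩) 2 R τ) atTop (𝓝 0))

include hΦ hOfut hsub hΛ hξ hT₀ hclock hpos hdec htop hA hhon hQA hconvR in
/-- **The reach profile of a clock chart.** A monotone profile `Rr → ∞` along which the rest chart
`Ψ_A` converges in `C²` and the certified Carter reach holds on `{r ≥ r₊ + 1}` after a model time
`S`: every model point `y` with `S ≤ y⁰ ≤ τ₁`, `r₊ + 1 ≤ r_a(y) ≤ Rr(y⁰)` lies in
`J⁻(Ψ_A({y⁰ = τ₁, r ≤ Rr(τ₁)}))`. [cite: Carter1968] -/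
theorem exists_clock_reach_r12 :
    ∃ (Rr : ℝ → ℝ) (S : ℝ), Monotone Rr ∧ Tendsto Rr atTop atTop ∧
      Tendsto (fun τ ↦ 𝓢.truncDeviationCk (boostedKerrBackground 1 0 M a)
        (fun y : (boostedKerrBackground 1 0 M a).domain ↦ Φ ⟨A y.1, hAU y.1 y.2⟩) 2 (Rr τ) τ)
        atTop (𝓝 0) ∧
      ∀ (y : (boostedKerrBackground 1 0 M a).domain) (τ₁ : ℝ), S ≤ y.1 0 → y.1 0 ≤ τ₁ →
        Kerr.rPlus M a + 1 ≤ Kerr.radius a y.1 → Kerr.radius a y.1 ≤ Rr (y.1 0) →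
        Φ ⟨A y.1, hAU y.1 y.2⟩ ∈ 𝓢.metric.causalPast 𝓢.timeOrientation
          ((fun y : (boostedKerrBackground 1 0 M a).domain ↦ Φ ⟨A y.1, hAU y.1 y.2⟩) ''
            {z | z.1 0 = τ₁ ∧ Kerr.radius a z.1 ≤ Rr τ₁}) := by
  set Kb := boostedKerrBackground 1 0 M a with hKb
  set Ψ : Kb.domain → 𝓢.carrier := fun y ↦ Φ ⟨A y.1, hAU y.1 y.2⟩ with hΨ
  have hrest : ∀ z : E4, Kb.time z = z 0 ∧ Kb.radius z = Kerr.radius a z := fun z ↦ by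
    constructor
    · show (poincareInv 1 0 z) 0 = z 0; rw [Literature.Geometry.Lorentzian.poincareInv_one_zero]
    · show Kerr.radius a (poincareInv 1 0 z) = _; rw [Literature.Geometry.Lorentzian.poincareInv_one_zero]
  -- a monotone cap along which the chart converges
  obtain ⟨Rg, hRgn, hRgt, hRgc⟩ := exists_growing_radius' (f := fun τ r ↦ 𝓢.truncDeviationCk Kb Ψ 2 r τ)
    fun n ↦ hconvR n
  have hRg0 : ∀ τ, 0 ≤ Rg τ := fun τ ↦ by obtain ⟨n, hn⟩ := hRgn τ; rw [hn]; exact n.cast_nonneg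
  obtain ⟨Rm, hRmm, hRmt, hRmle⟩ := exists_monotone_minorant hRg0 hRgt
  set cap : ℝ → ℝ := fun t ↦ max (Rm t) 0 with hcap
  have hcapm : Monotone cap := fun s t h ↦ max_le_max (hRmm h) le_rfl
  have hcapt : Tendsto cap atTop atTop := tendsto_atTop_mono (fun t ↦ le_max_left _ _) hRmt
  have hcapc : Tendsto (fun τ ↦ 𝓢.truncDeviationCk Kb Ψ 2 (cap τ) τ) atTop (𝓝 0) := by
    refine tendsto_truncDeviationCk_max 𝓢 Kb Ψ 2 ?_ (hconvR 0)
    exact tendsto_of_tendsto_of_tendsto_of_le_of_le tendsto_const_nhds hRgc (fun _ ↦ bot_le)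
      fun τ ↦ 𝓢.truncDeviationCk_mono Kb Ψ 2 (hRmle τ) τ
  -- the time-raising profile below the cap, and the reach profile
  obtain ⟨R, hRm, hRt, hRcap, S₁, hraise⟩ := exists_carter_hraise Λ ξ T₀ hΛ hξ hT₀ hclock hpos hdec htop a
    hhon cap hcapm hcapt hsub
  set Rr : ℝ → ℝ := fun t ↦ R t - |a| with hRr
  have hRrm : Monotone Rr := fun s t h ↦ sub_le_sub_right (hRm h) _
  have hRrt : Tendsto Rr atTop atTop := tendsto_atTop_add_const_right _ _ hRt
  have hRrle : ∀ t, Rr t ≤ cap t := fun t ↦ by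
    have h1 : Rr t ≤ R t := sub_le_self _ (abs_nonneg a)
    have h2 : max (cap t) 0 = cap t := max_eq_left (le_max_right _ _)
    exact h1.trans ((hRcap t).trans h2.le)
  have hRrc : Tendsto (fun τ ↦ 𝓢.truncDeviationCk Kb Ψ 2 (Rr τ) τ) atTop (𝓝 0) :=
    tendsto_of_tendsto_of_tendsto_of_le_of_le tendsto_const_nhds hcapc (fun _ ↦ bot_le)
      fun τ ↦ 𝓢.truncDeviationCk_mono Kb Ψ 2 (hRrle τ) τ
  -- the Carter reach along `Rr`
  have hraise' : ∀ y ∈ Kb.domain, S₁ ≤ Kb.time y → Kb.radius y ≤ Rr (Kb.time y) →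
      1 / 8 ≤ (fderiv ℝ A y (((1 : lorentzGroup) : E4 ≃L[ℝ] E4) (carterField a (poincareInv 1 0 y)))) 0 :=
    fun y hy hyS hyR ↦ hraise y hy hyS (by show Kb.radius y ≤ R (Kb.time y) - |a|; exact hyR)
  obtain ⟨S, hS⟩ := exists_carter_reach 1 0 hsub U Φ hΦ hA hAU Qp hOfut hQA Rr hRrm hRrc hraise' one_pos
  refine ⟨Rr, S, hRrm, hRrt, hRrc, fun y τ₁ hyS hy₁ hyr hyR ↦ ?_⟩
  have h := hS y τ₁ (by rw [(hrest y.1).1]; exact hyS) (by rw [(hrest y.1).1]; exact hy₁)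
    (by rw [(hrest y.1).2]; exact hyr) (by rw [(hrest y.1).1, (hrest y.1).2]; exact hyR)
  have hset : Kb.truncTimeSlab (Rr τ₁) τ₁ = {z : Kb.domain | z.1 0 = τ₁ ∧ Kerr.radius a z.1 ≤ Rr τ₁} := by
    ext z
    rw [ModelBackground.mem_truncTimeSlab, (hrest z.1).1, (hrest z.1).2]
    rfl
  rw [hset] at h
  exact h

end Reach

/-- Registered one-line form (carrier `radius_le_spatialNorm_rechart12` of the crux item) of
`Kerr.radius_le_spatialNorm` (`r_a(x) ≤ ‖x̃‖`, Visser arXiv:0706.0622, (35)). [cite: arXiv07060622, (35)] -/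
theorem radius_le_spatialNorm_rechart12 : open Literature.Geometry.Lorentzian in ∀ (a : ℝ) (x : E4), Kerr.radius a x ≤ E4.spatialNorm x :=
  fun a x ↦ Kerr.radius_le_spatialNorm a x

end Summit.FinalStateConjecture.FinalStateConjecture.Theorems

end
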